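import Summits.Ventures.LatticeQCDFlow.Scaling.IdealStarLawFreeKLogK
import Summits.Ventures.LatticeQCDFlow.Scaling.HomStarStationaryLumping
import Summits.Ventures.LatticeQCDFlow.Scaling.PartialLazyBinomialClock

/-!
HONEST FRAMING: exact (Metropolis-corrected) sampling algorithms for lattice gauge theory; figures
of merit are autocorrelation/cost numbers at stated couplings and volumes; no continuum-physics
claim.

# HomStarLazyLawFreeFloor — CHAPTER U's ACTUAL HOMOGENEOUS SCHEME AT CONSTANT PERSISTENCE IS THE IDEALISED STAR RUN AT A BINOMIAL CLOCK: WITH `h = (1−t)w_0` AND `q = t + h`,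
# `P = q·P′ + (1−q)·I` FOR THE HOT-ONLY IDEALISED STAR `P′` AT `t′ = t/q`, SO `δ_y Pⁿ = Σ_j Bin(n,q)(j)·δ_y P′ʲ`; AE12's COMPOSITION EVENT THEN GIVES, FOR EVERY CONTENT LAW WITH
# SOME `ν(u) ≤ ½`, `‖δ_{y_u}Pⁿ − ⊗ν‖_TV > ¼` WHENEVER `4qn + 4 ≤ n₀′ := (Kq²/(th) − 1)·log((K+t′)/max{260, 8√(2(K+1))})`, I.E. `t_mix(1/4) ≥ (n₀′ − 4)/(4q)` — THE UNIT
# `K(t+h)/(4th)` TIMES `log K`, LAW-FREE (lean-2 GEN-45, ours)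

Venture-side (OURS).  Cell `lqcd-flow` (pub-lqcd), unit `pub-lqcd-lean-2-g45`, 2026-08-31.  Chapter AE, file 18 — file 12 carried to chapter U's homogeneous replica-exchange star itself
(hot level redrawn with weight `w_0 < 1`, cold levels idle, `μ_k ≡ ν`): the configuration kernel is a partially lazy version of the idealised hot-only star, the binomial time change is
exact (file 17: `lawAt_partialLazy_choose`, `partialLazy_tvDist_ge` — Markov for the clock), and AE12's composition event has `δ_{y_u}P′ʲ`-mass `≥ ⅝` up to AE12's horizon.

* `pow_horizon_ge`, `prodKernel_idle_eq`, `homStar_eq_partialLazy` (the kernel identity), `idealStar_event_mass_ge`, **`homStar_lazy_event_mass_ge`** (the composition event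
  `{#u ≥ (K+1)ν(u) + √(2(K+1))}` keeps `δ_{y_u}Pⁿ`-mass `≥ 15/32` while `4qn + 4 ≤ n₀′`; its `⊗ν`-mass is `≤ ⅛`), **`homStar_lazy_tvDist_gt_quarter`**, **`homStar_lazy_lt_mixingTime`**,
  **`homStar_lazy_mixingTime_ge_lawFree`** (`t_mix(1/4) ≥ (n₀′ − 4)/(4q)`, given `¼`-closeness at some time).

Reading (no numerics implied): with chapter U ∕ AD's ceilings for the same scheme (`O((K/(t·h·p̄))·log(K/ε))` in scheme steps, `p̄ = ½` at constant persistence) the homogeneous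
star's configuration law at `μ_k ≡ ν` is `Θ((K/(th))·log K)` up to the factor `(t+h)²/4 ∈ (0, ¼]` — two-sided INCLUDING THE LOGARITHM, for every content law with two or more
contents (the event is a composition event, so the same floor holds for the POOLED law against `π_S` — file 19 — which is the law chapter AD's ceiling speaks of).  NOT CLAIMED:
persistence (`μ_1 ≠ μ_0`); Chebyshev in place of Markov would give `(n₀′ − 4)/(2q)`.  Literature grade (cell rule): OWN assembly on file 12 and AD15 [cite: LevinPeres2017, §5.3 proof of Prop. 5.7 (the binomial clock of a lazy chain)]; no new bib keys.
-/

noncomputable section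

open Finset Function
open Literature.Probability.MarkovChains

namespace Summit.Ventures.LatticeQCDFlow.Scaling


/-! ## The homogeneous star is the idealised star at a binomial clock -/

section Horizon

/-- **The horizon arithmetic:** `0 < θ < 1`, `A, C > 0`, `j ≤ ((1−θ)/θ)·log(A/C)` ⇒ `C ≤ (1−θ)ʲA`. [ours] -/
theorem pow_horizon_ge {θ A C : ℝ} (hθ0 : 0 < θ) (hθ1 : θ < 1) (hA : 0 < A) (hC : 0 < C) {j : ℕ} (hj : (j : ℝ) ≤ (1 - θ) / θ * Real.log (A / C)) :
    C ≤ (1 - θ) ^ j * A := by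
  have h1θ : 0 < 1 - θ := by linarith
  have hle := mul_le_mul_of_nonneg_left hj (div_pos hθ0 h1θ).le
  have e0 : θ / (1 - θ) * ((1 - θ) / θ) = 1 := by rw [div_mul_div_comm, mul_comm θ (1 - θ)]; exact div_self (mul_ne_zero h1θ.ne' hθ0.ne')
  have e1 : θ / (1 - θ) * ((1 - θ) / θ * Real.log (A / C)) = Real.log (A / C) := by rw [← mul_assoc, e0, one_mul]
  have e2 : θ / (1 - θ) * (j : ℝ) = j * θ / (1 - θ) := by ring
  rw [e1, e2] at hle
  calc C = A * Real.exp (-Real.log (A / C)) := by rw [Real.exp_neg, Real.exp_log (div_pos hA hC)]; field_simp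
    _ ≤ A * Real.exp (-(j * θ / (1 - θ))) := mul_le_mul_of_nonneg_left (Real.exp_le_exp.mpr (neg_le_neg hle)) hA.le
    _ ≤ A * (1 - θ) ^ j := mul_le_mul_of_nonneg_left (one_sub_pow_ge_exp hθ1 j) hA.le
    _ = (1 - θ) ^ j * A := mul_comm _ _

end Horizon

section HomStarLazy
variable {S : Type*} [Fintype S] [DecidableEq S] {K m : ℕ} (κ : Fin m → Fin K) {ν : S → ℝ} {M : Fin (K + 1) → S → S → ℝ} {w : Fin (K + 1) → ℝ} {t : ℝ}

omit [Fintype S] in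
/-- With idle cold levels the product part is `w_0·(hot move) + (1 − w_0)·I`. [ours] -/
theorem prodKernel_idle_eq (hidle : ∀ i : Fin K, ∀ u v, M i.succ u v = if v = u then 1 else 0) (hw1 : ∑ k, w k = 1) (y z : Fin (K + 1) → S) :
    prodKernel w M y z = w 0 * prodKernel (fun k : Fin (K + 1) => if k = 0 then (1 : ℝ) else 0) M y z + (1 - w 0) * (if z = y then 1 else 0) := by
  classical
  have hk : ∀ i : Fin K, coordKernel M i.succ y z = if z = y then 1 else 0 := by
    intro i
    unfold coordKernel
    rw [hidle]
    by_cases hz : z = y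
    · subst hz; rw [if_pos rfl, if_pos rfl, if_pos]; rw [update_eq_self]
    · rw [if_neg hz]
      by_cases h1 : z = update y i.succ (z i.succ)
      · rw [if_pos h1, if_neg]
        intro h2; apply hz
        rw [h1, h2, update_eq_self]
      · rw [if_neg h1]
  have h0 : prodKernel (fun k : Fin (K + 1) => if k = 0 then (1 : ℝ) else 0) M y z = coordKernel M 0 y z := by
    unfold prodKernel
    rw [Fin.sum_univ_succ]; simp [Fin.succ_ne_zero]
  have hw : ∑ i : Fin K, w i.succ = 1 - w 0 := by rw [Fin.sum_univ_succ] at hw1; linarith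
  rw [h0]
  unfold prodKernel
  rw [Fin.sum_univ_succ]
  simp_rw [hk]
  rw [← sum_mul, hw]

/-- **THE KERNEL IDENTITY:** with `h = (1−t)w_0`, `q = t + h`, `t′ = t/q`, chapter U's homogeneous kernel is `q·P′ + (1−q)·I` for the idealised hot-only star `P′` at swap
probability `t′`. [ours] -/
theorem homStar_eq_partialLazy (hidle : ∀ i : Fin K, ∀ u v, M i.succ u v = if v = u then 1 else 0) (hw1 : ∑ k, w k = 1) (hq : t + (1 - t) * w 0 ≠ 0) :
    (fun y z : Fin (K + 1) → S => t * ptGraphSwap (fun _ : Fin (K + 1) => ν)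
          (fun r : Fin m => (((0 : Fin (K + 1)), (κ r).succ) : Fin (K + 1) × Fin (K + 1))) (fun _ => Equiv.refl S) y z
          + (1 - t) * prodKernel w M y z)
      = fun y z => (t + (1 - t) * w 0) * ((t / (t + (1 - t) * w 0)) * ptGraphSwap (fun _ : Fin (K + 1) => ν)
          (fun r : Fin m => (((0 : Fin (K + 1)), (κ r).succ) : Fin (K + 1) × Fin (K + 1))) (fun _ => Equiv.refl S) y z
          + (1 - t / (t + (1 - t) * w 0)) * prodKernel (fun k : Fin (K + 1) => if k = 0 then (1 : ℝ) else 0) M y z)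
        + (1 - (t + (1 - t) * w 0)) * (if z = y then 1 else 0) := by
  classical
  funext y z
  rw [prodKernel_idle_eq hidle hw1]
  field_simp
  ring

variable {c : ℕ}

/-- **AE12's event under the idealised star:** with `s = (1−t(1−t)/K)ʲ(K+t) ≥ max{260, 8√(2(K+1))}` and `ν(u) ≤ ½`, the composition event
`{#u ≥ (K+1)ν(u) + √(2(K+1))}` has `δ_{y_u}P′ʲ`-mass `≥ ⅝`. [ours] -/
theorem idealStar_event_mass_ge (hm : 1 ≤ m) (ht0 : 0 < t) (ht1 : t < 1) (hK : 2 ≤ K) (hν : ∀ v, 0 < ν v) (hν1 : ∑ v, ν v = 1)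
    (hM : ∀ k, IsRowStochastic (M k)) (hM0 : ∀ u v, M 0 u v = ν v)
    (hunif : ∀ i : Fin K, (univ.filter fun r : Fin m => κ r = i).card = c) (hmc : m = c * K) (u : S) (hu : ν u ≤ 1 / 2) (j : ℕ)
    (hs64 : 260 ≤ (1 - t * (1 - t) / K) ^ j * ((K : ℝ) + t)) (hs8 : 8 * Real.sqrt (2 * ((K : ℝ) + 1)) ≤ (1 - t * (1 - t) / K) ^ j * ((K : ℝ) + t)) :
    5 / 8 ≤ ∑ z ∈ univ.filter (fun z : Fin (K + 1) → S => ((K : ℝ) + 1) * ν u + Real.sqrt (2 * ((K : ℝ) + 1)) ≤ ∑ k, (if z k = u then (1 : ℝ) else 0)),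
      lawAt (fun y z : Fin (K + 1) → S => t * ptGraphSwap (fun _ : Fin (K + 1) => ν)
          (fun r : Fin m => (((0 : Fin (K + 1)), (κ r).succ) : Fin (K + 1) × Fin (K + 1))) (fun _ => Equiv.refl S) y z
          + (1 - t) * prodKernel (fun k : Fin (K + 1) => if k = 0 then (1 : ℝ) else 0) M y z) (Pi.single (fun _ : Fin (K + 1) => u) 1) j z := by
  classical
  set P' := (fun y z : Fin (K + 1) → S => t * ptGraphSwap (fun _ : Fin (K + 1) => ν)
          (fun r : Fin m => (((0 : Fin (K + 1)), (κ r).succ) : Fin (K + 1) × Fin (K + 1))) (fun _ => Equiv.refl S) y z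
          + (1 - t) * prodKernel (fun k : Fin (K + 1) => if k = 0 then (1 : ℝ) else 0) M y z) with hP'
  have hlam : 0 < Real.sqrt (2 * ((K : ℝ) + 1)) := Real.sqrt_pos.mpr (by positivity)
  have hlam2 : Real.sqrt (2 * ((K : ℝ) + 1)) ^ 2 = 2 * ((K : ℝ) + 1) := Real.sq_sqrt (by positivity)
  have hνu : ν u * (1 - ν u) ≤ 1 / 4 := by nlinarith only [hu, sq_nonneg (ν u - 1 / 2)]
  have hKx := mul_le_mul_of_nonneg_left hνu (by positivity : (0 : ℝ) ≤ (K : ℝ) + 1)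
  have hcheb : ((K : ℝ) + 1) * (ν u * (1 - ν u)) / Real.sqrt (2 * ((K : ℝ) + 1)) ^ 2 ≤ 1 / 8 := by
    rw [hlam2, div_le_iff₀ (by positivity)]; linarith only [hKx]
  have hdef := idealStar_count_deficit_le_unit κ hm ht0 ht1 hK hν hν1 hM hM0 hunif hmc u hu j hlam hs8
  rw [← hP'] at hdef
  have h4s := quarter_of_ge_260 hs64
  have hP'rs : IsRowStochastic P' := by
    have h1 := ptGraphSwap_isRowStochastic (e := fun r : Fin m => (((0 : Fin (K + 1)), (κ r).succ) : Fin (K + 1) × Fin (K + 1))) (φ := fun _ => Equiv.refl S)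
      (μ := fun _ : Fin (K + 1) => ν) (fun _ v => hν v)
    have h10 : ∀ k : Fin (K + 1), 0 ≤ (if k = 0 then (1 : ℝ) else 0) := fun k => by split_ifs <;> norm_num
    have h11 : ∑ k : Fin (K + 1), (if k = 0 then (1 : ℝ) else 0) = 1 := by simp
    have h2 := prodKernel_isRowStochastic (P := M) (w := fun k : Fin (K + 1) => if k = 0 then (1 : ℝ) else 0) h10 h11 hM
    refine ⟨fun y z => ?_, fun y => ?_⟩
    · rw [hP']; exact add_nonneg (mul_nonneg ht0.le (h1.1 y z)) (mul_nonneg (by linarith) (h2.1 y z))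
    · rw [hP']; simp only
      rw [sum_add_distrib, ← mul_sum, ← mul_sum, h1.2 y, h2.2 y]; ring
  have htot : ∑ z, lawAt P' (Pi.single (fun _ : Fin (K + 1) => u) 1) j z = 1 := by rw [sum_lawAt hP'rs, Finset.sum_pi_single']; simp
  have hsplit := Finset.sum_filter_add_sum_filter_not univ
    (fun z : Fin (K + 1) → S => ((K : ℝ) + 1) * ν u + Real.sqrt (2 * ((K : ℝ) + 1)) ≤ ∑ k, (if z k = u then (1 : ℝ) else 0))
    (fun z => lawAt P' (Pi.single (fun _ : Fin (K + 1) => u) 1) j z)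
  rw [htot] at hsplit
  have hAc : univ.filter (fun z : Fin (K + 1) → S => ∑ k, (if z k = u then (1 : ℝ) else 0) < ((K : ℝ) + 1) * ν u + Real.sqrt (2 * ((K : ℝ) + 1)))
      = univ.filter (fun z : Fin (K + 1) → S => ¬ (((K : ℝ) + 1) * ν u + Real.sqrt (2 * ((K : ℝ) + 1)) ≤ ∑ k, (if z k = u then (1 : ℝ) else 0))) := by
    simp only [not_le]
  rw [hAc] at hdef
  linarith only [hsplit, hdef, h4s, hcheb]

/-- **THE COMPOSITION EVENT KEEPS ITS MASS BEFORE THE BINOMIAL CLOCK REACHES AE12's HORIZON:** `K ≥ 2`, `0 < t < 1`, `0 < w_0`, `Σw = 1`, `w ≥ 0`, exact hot redraws, idle cold levels,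
uniform listing (`m = cK`, `c ≥ 1`), `ν > 0` of unit mass with `ν(u) ≤ ½`; `h = (1−t)w_0`, `q = t + h`, `t′ = t/q`, `n₀′ = (Kq²/(th) − 1)·log((K+t′)/max{260, 8√(2(K+1))})`:
for every `n` with `4qn + 4 ≤ n₀′`, **`(δ_{y_u}Pⁿ){#u ≥ (K+1)ν(u) + √(2(K+1))} ≥ 15/32`**. [ours] -/
theorem homStar_lazy_event_mass_ge (hm : 1 ≤ m) (ht0 : 0 < t) (ht1 : t < 1) (hK : 2 ≤ K) (hν : ∀ v, 0 < ν v) (hν1 : ∑ v, ν v = 1)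
    (hM0 : ∀ u v, M 0 u v = ν v) (hidle : ∀ i : Fin K, ∀ u v, M i.succ u v = if v = u then 1 else 0)
    (hw0 : ∀ k, 0 ≤ w k) (hw00 : 0 < w 0) (hw1 : ∑ k, w k = 1)
    (hunif : ∀ i : Fin K, (univ.filter fun r : Fin m => κ r = i).card = c) (hmc : m = c * K) (u : S) (hu : ν u ≤ 1 / 2) {n : ℕ}
    (hn : 4 * (t + (1 - t) * w 0) * n + 4 ≤ ((K : ℝ) * (t + (1 - t) * w 0) ^ 2 / (t * ((1 - t) * w 0)) - 1)
        * Real.log (((K : ℝ) + t / (t + (1 - t) * w 0)) / max 260 (8 * Real.sqrt (2 * ((K : ℝ) + 1))))) :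
    15 / 32 ≤ ∑ z ∈ univ.filter (fun z : Fin (K + 1) → S => ((K : ℝ) + 1) * ν u + Real.sqrt (2 * ((K : ℝ) + 1)) ≤ ∑ k, (if z k = u then (1 : ℝ) else 0)),
      lawAt (fun y z : Fin (K + 1) → S => t * ptGraphSwap (fun _ : Fin (K + 1) => ν)
          (fun r : Fin m => (((0 : Fin (K + 1)), (κ r).succ) : Fin (K + 1) × Fin (K + 1))) (fun _ => Equiv.refl S) y z
          + (1 - t) * prodKernel w M y z) (Pi.single (fun _ : Fin (K + 1) => u) 1) n z := by
  classical
  -- names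
  have h1t : 0 < 1 - t := by linarith
  have hh : 0 < (1 - t) * w 0 := mul_pos h1t hw00
  set q : ℝ := t + (1 - t) * w 0 with hqdef
  have hq0 : 0 < q := by rw [hqdef]; linarith
  have hw0le : w 0 ≤ 1 := by
    have := Finset.single_le_sum (fun k _ => hw0 k) (mem_univ (0 : Fin (K + 1))); rw [hw1] at this; exact this
  have hq1 : q ≤ 1 := by rw [hqdef]; nlinarith
  set t' : ℝ := t / q with ht'def
  have ht'0 : 0 < t' := div_pos ht0 hq0
  have ht'1 : t' < 1 := by rw [ht'def, div_lt_one hq0, hqdef]; linarith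
  have h1t' : 1 - t' = (1 - t) * w 0 / q := by rw [ht'def]; field_simp; rw [hqdef]; ring
  set C : ℝ := max 260 (8 * Real.sqrt (2 * ((K : ℝ) + 1))) with hC
  have hKpos : (0 : ℝ) < K := by exact_mod_cast (by omega : 0 < K)
  have hK2 : (2 : ℝ) ≤ K := by exact_mod_cast hK
  have hCpos : 0 < C := lt_of_lt_of_le (by norm_num) (le_max_left _ _)
  have hθ0 : 0 < t' * (1 - t') / K := div_pos (mul_pos ht'0 (by linarith)) hKpos
  have hθ1 : t' * (1 - t') / K < 1 := by rw [div_lt_one hKpos]; nlinarith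
  have hKt : (0 : ℝ) < (K : ℝ) + t' := by linarith
  -- the horizon in the unit of `P′`
  have e1 : t' * (1 - t') = t * ((1 - t) * w 0) / (q * q) := by rw [h1t', ht'def, div_mul_div_comm]
  have hθ : t' * (1 - t') / K = t * ((1 - t) * w 0) / (q ^ 2 * K) := by rw [e1, div_div, pow_two]
  have hθ' : 1 / (t' * (1 - t') / K) = (K : ℝ) * q ^ 2 / (t * ((1 - t) * w 0)) := by rw [hθ, one_div_div, mul_comm]
  have hconv : (K : ℝ) * q ^ 2 / (t * ((1 - t) * w 0)) - 1 = (1 - t' * (1 - t') / K) / (t' * (1 - t') / K) := by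
    rw [sub_div, div_self hθ0.ne', hθ']
  set n₀ : ℝ := ((K : ℝ) * q ^ 2 / (t * ((1 - t) * w 0)) - 1) * Real.log (((K : ℝ) + t') / C) with hn₀def
  have hn' : 4 * q * n + 4 ≤ n₀ := hn
  have h4qn : 0 ≤ 4 * q * n := by positivity
  have hn₀4 : 4 ≤ n₀ := by linarith
  set N : ℕ := ⌊n₀⌋₊ with hNdef
  have hNle : (N : ℝ) ≤ n₀ := Nat.floor_le (by linarith)
  have hNlt : n₀ < N + 1 := Nat.lt_floor_add_one n₀
  -- `s_j ≥ C` for `j ≤ N`, hence AE12's event has mass `≥ ⅝` under `δ P′ʲ`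
  have hMrs : ∀ k, IsRowStochastic (M k) := by
    intro k
    refine Fin.cases ?_ (fun i => ?_) k
    · exact ⟨fun a b => by rw [hM0]; exact (hν b).le, fun a => by simp_rw [hM0]; exact hν1⟩
    · refine ⟨fun a b => by rw [hidle]; split_ifs <;> norm_num, fun a => ?_⟩
      simp_rw [hidle]; rw [Finset.sum_ite_eq' univ a]; simp
  have hsj : ∀ j : ℕ, j ≤ N → C ≤ (1 - t' * (1 - t') / K) ^ j * ((K : ℝ) + t') := fun j hj =>
    pow_horizon_ge hθ0 hθ1 hKt hCpos (by rw [← hconv, ← hn₀def]; exact le_trans (by exact_mod_cast hj) hNle)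
  have hmassj : ∀ j : ℕ, j ≤ N → 5 / 8 ≤ ∑ z ∈ univ.filter (fun z : Fin (K + 1) → S => ((K : ℝ) + 1) * ν u + Real.sqrt (2 * ((K : ℝ) + 1)) ≤ ∑ k, (if z k = u then (1 : ℝ) else 0)),
      lawAt (fun y z : Fin (K + 1) → S => t' * ptGraphSwap (fun _ : Fin (K + 1) => ν)
          (fun r : Fin m => (((0 : Fin (K + 1)), (κ r).succ) : Fin (K + 1) × Fin (K + 1))) (fun _ => Equiv.refl S) y z
          + (1 - t') * prodKernel (fun k : Fin (K + 1) => if k = 0 then (1 : ℝ) else 0) M y z) (Pi.single (fun _ : Fin (K + 1) => u) 1) j z :=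
    fun j hj => idealStar_event_mass_ge κ hm ht'0 ht'1 hK hν hν1 hMrs hM0 hunif hmc u hu j (le_trans (le_max_left _ _) (hsj j hj))
      (le_trans (le_max_right _ _) (hsj j hj))
  -- the binomial clock and the product law's mass of the event
  have hP'rs : IsRowStochastic (fun y z : Fin (K + 1) → S => t' * ptGraphSwap (fun _ : Fin (K + 1) => ν)
          (fun r : Fin m => (((0 : Fin (K + 1)), (κ r).succ) : Fin (K + 1) × Fin (K + 1))) (fun _ => Equiv.refl S) y z
          + (1 - t') * prodKernel (fun k : Fin (K + 1) => if k = 0 then (1 : ℝ) else 0) M y z) := by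
    have h1 := ptGraphSwap_isRowStochastic (e := fun r : Fin m => (((0 : Fin (K + 1)), (κ r).succ) : Fin (K + 1) × Fin (K + 1))) (φ := fun _ => Equiv.refl S)
      (μ := fun _ : Fin (K + 1) => ν) (fun _ v => hν v)
    have h10 : ∀ k : Fin (K + 1), 0 ≤ (if k = 0 then (1 : ℝ) else 0) := fun k => by split_ifs <;> norm_num
    have h11 : ∑ k : Fin (K + 1), (if k = 0 then (1 : ℝ) else 0) = 1 := by simp
    have h2 := prodKernel_isRowStochastic (P := M) (w := fun k : Fin (K + 1) => if k = 0 then (1 : ℝ) else 0) h10 h11 hMrs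
    refine ⟨fun y z => add_nonneg (mul_nonneg ht'0.le (h1.1 y z)) (mul_nonneg (by linarith) (h2.1 y z)), fun y => ?_⟩
    simp only
    rw [sum_add_distrib, ← mul_sum, ← mul_sum, h1.2 y, h2.2 y]; ring
  have hB := partialLazy_mass_ge hP'rs hq0.le hq1 (fun _ : Fin (K + 1) => u)
    (univ.filter (fun z : Fin (K + 1) → S => ((K : ℝ) + 1) * ν u + Real.sqrt (2 * ((K : ℝ) + 1)) ≤ ∑ k, (if z k = u then (1 : ℝ) else 0)))
    (by norm_num : (0 : ℝ) ≤ 5 / 8) hmassj n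
  have hker := homStar_eq_partialLazy κ (ν := ν) (t := t) (M := M) hidle hw1 hq0.ne'
  rw [← hqdef, ← ht'def] at hker
  rw [hker]
  -- Markov for the clock: `nq/(N+1) ≤ ¼` since `4nq ≤ n₀ − 4 < N − 3`
  have htail : (n : ℝ) * q / ((N : ℝ) + 1) ≤ 1 / 4 := by
    rw [div_le_iff₀ (by positivity)]
    linarith only [hn', hNlt]
  have h58 : 5 / 8 * (3 / 4 : ℝ) ≤ 5 / 8 * (1 - n * q / ((N : ℝ) + 1)) := by linarith only [htail]
  linarith only [hB, h58]

/-- **THE DISTANCE STAYS ABOVE `¼` BEFORE THE BINOMIAL CLOCK REACHES AE12's HORIZON:** for every `n` with `4qn + 4 ≤ n₀′` (notation of `homStar_lazy_event_mass_ge`),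
**`‖δ_{y_u}Pⁿ − ⊗ν‖_TV > ¼`** (`≥ 15/32 − ⅛`). [ours] -/
theorem homStar_lazy_tvDist_gt_quarter (hm : 1 ≤ m) (ht0 : 0 < t) (ht1 : t < 1) (hK : 2 ≤ K) (hν : ∀ v, 0 < ν v) (hν1 : ∑ v, ν v = 1)
    (hM0 : ∀ u v, M 0 u v = ν v) (hidle : ∀ i : Fin K, ∀ u v, M i.succ u v = if v = u then 1 else 0)
    (hw0 : ∀ k, 0 ≤ w k) (hw00 : 0 < w 0) (hw1 : ∑ k, w k = 1)
    (hunif : ∀ i : Fin K, (univ.filter fun r : Fin m => κ r = i).card = c) (hmc : m = c * K) (u : S) (hu : ν u ≤ 1 / 2) {n : ℕ}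
    (hn : 4 * (t + (1 - t) * w 0) * n + 4 ≤ ((K : ℝ) * (t + (1 - t) * w 0) ^ 2 / (t * ((1 - t) * w 0)) - 1)
        * Real.log (((K : ℝ) + t / (t + (1 - t) * w 0)) / max 260 (8 * Real.sqrt (2 * ((K : ℝ) + 1))))) :
    1 / 4 < tvDist (lawAt (fun y z : Fin (K + 1) → S => t * ptGraphSwap (fun _ : Fin (K + 1) => ν)
          (fun r : Fin m => (((0 : Fin (K + 1)), (κ r).succ) : Fin (K + 1) × Fin (K + 1))) (fun _ => Equiv.refl S) y z
          + (1 - t) * prodKernel w M y z) (Pi.single (fun _ : Fin (K + 1) => u) 1) n) (tensorFun (fun _ : Fin (K + 1) => ν)) := by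
  classical
  have hmass := homStar_lazy_event_mass_ge κ hm ht0 ht1 hK hν hν1 hM0 hidle hw0 hw00 hw1 hunif hmc u hu hn
  have hexc := tensor_count_excess_le (K := K) hν hν1 u (Real.sqrt_pos.mpr (by positivity) : 0 < Real.sqrt (2 * ((K : ℝ) + 1)))
  have hlam2 : Real.sqrt (2 * ((K : ℝ) + 1)) ^ 2 = 2 * ((K : ℝ) + 1) := Real.sq_sqrt (by positivity)
  have hνu : ν u * (1 - ν u) ≤ 1 / 4 := by nlinarith only [hu, sq_nonneg (ν u - 1 / 2)]
  have hKx := mul_le_mul_of_nonneg_left hνu (by positivity : (0 : ℝ) ≤ (K : ℝ) + 1)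
  have hcheb : ((K : ℝ) + 1) * (ν u * (1 - ν u)) / Real.sqrt (2 * ((K : ℝ) + 1)) ^ 2 ≤ 1 / 8 := by
    rw [hlam2, div_le_iff₀ (by positivity)]; linarith only [hKx]
  have hμ : ∀ (k : Fin (K + 1)) (x : S), 0 < (fun _ : Fin (K + 1) => ν) k x := fun _ x => hν x
  have hrow := homStar_tensor_rowsum (K := K) (m := m) (w := w) (t := t) (M := M) hμ (fun _ => hν1) hw0 hw1 hM0 hidle
    (fun r : Fin m => (((0 : Fin (K + 1)), (κ r).succ) : Fin (K + 1) × Fin (K + 1))) (fun _ : Fin m => Equiv.refl S)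
  have hMrs : ∀ k, IsRowStochastic (M k) := by
    intro k
    refine Fin.cases ?_ (fun i => ?_) k
    · exact ⟨fun a b => by rw [hM0]; exact (hν b).le, fun a => by simp_rw [hM0]; exact hν1⟩
    · refine ⟨fun a b => by rw [hidle]; split_ifs <;> norm_num, fun a => ?_⟩
      simp_rw [hidle]; rw [Finset.sum_ite_eq' univ a]; simp
  have hPrs : IsRowStochastic (fun y z : Fin (K + 1) → S => t * ptGraphSwap (fun _ : Fin (K + 1) => ν)
          (fun r : Fin m => (((0 : Fin (K + 1)), (κ r).succ) : Fin (K + 1) × Fin (K + 1))) (fun _ => Equiv.refl S) y z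
          + (1 - t) * prodKernel w M y z) := by
    refine ⟨fun y z => ?_, fun y => hrow y⟩
    have h1 := (ptGraphSwap_isRowStochastic (e := fun r : Fin m => (((0 : Fin (K + 1)), (κ r).succ) : Fin (K + 1) × Fin (K + 1))) (φ := fun _ => Equiv.refl S) hμ).1 y z
    have h2 := (prodKernel_isRowStochastic (P := M) (w := w) hw0 hw1 hMrs).1 y z
    exact add_nonneg (mul_nonneg ht0.le h1) (mul_nonneg (by linarith) h2)
  have hl1 : ∑ z, lawAt (fun y z : Fin (K + 1) → S => t * ptGraphSwap (fun _ : Fin (K + 1) => ν)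
          (fun r : Fin m => (((0 : Fin (K + 1)), (κ r).succ) : Fin (K + 1) × Fin (K + 1))) (fun _ => Equiv.refl S) y z
          + (1 - t) * prodKernel w M y z) (Pi.single (fun _ : Fin (K + 1) => u) 1) n z = ∑ z, tensorFun (fun _ : Fin (K + 1) => ν) z := by
    rw [sum_lawAt hPrs, Finset.sum_pi_single', if_pos (mem_univ _), sum_tensorFun_eq_one (fun _ : Fin (K + 1) => ν) (fun _ => hν1)]
  have htv := sub_sum_le_tvDist hl1
    (univ.filter (fun z : Fin (K + 1) → S => ((K : ℝ) + 1) * ν u + Real.sqrt (2 * ((K : ℝ) + 1)) ≤ ∑ k, (if z k = u then (1 : ℝ) else 0)))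
  linarith only [hmass, hexc, hcheb, htv]

/-- **BEFORE `(n₀′ − 4)/(4q)` THE SCHEME IS NOT MIXED:** if the scheme is `¼`-close to `⊗ν` at some time, every `n` with `4qn + 4 ≤ n₀′` has **`n < t_mix(1/4)`**. [ours] -/
theorem homStar_lazy_lt_mixingTime (hm : 1 ≤ m) (ht0 : 0 < t) (ht1 : t < 1) (hK : 2 ≤ K) (hν : ∀ v, 0 < ν v) (hν1 : ∑ v, ν v = 1)
    (hM0 : ∀ u v, M 0 u v = ν v) (hidle : ∀ i : Fin K, ∀ u v, M i.succ u v = if v = u then 1 else 0)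
    (hw0 : ∀ k, 0 ≤ w k) (hw00 : 0 < w 0) (hw1 : ∑ k, w k = 1)
    (hunif : ∀ i : Fin K, (univ.filter fun r : Fin m => κ r = i).card = c) (hmc : m = c * K) (u : S) (hu : ν u ≤ 1 / 2)
    (hmix : ∃ t₀, worstTvDist (fun y z : Fin (K + 1) → S => t * ptGraphSwap (fun _ : Fin (K + 1) => ν)
          (fun r : Fin m => (((0 : Fin (K + 1)), (κ r).succ) : Fin (K + 1) × Fin (K + 1))) (fun _ => Equiv.refl S) y z
          + (1 - t) * prodKernel w M y z) (tensorFun (fun _ : Fin (K + 1) => ν)) t₀ ≤ 1 / 4) {n : ℕ}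
    (hn : 4 * (t + (1 - t) * w 0) * n + 4 ≤ ((K : ℝ) * (t + (1 - t) * w 0) ^ 2 / (t * ((1 - t) * w 0)) - 1)
        * Real.log (((K : ℝ) + t / (t + (1 - t) * w 0)) / max 260 (8 * Real.sqrt (2 * ((K : ℝ) + 1))))) :
    n < mixingTime (fun y z : Fin (K + 1) → S => t * ptGraphSwap (fun _ : Fin (K + 1) => ν)
          (fun r : Fin m => (((0 : Fin (K + 1)), (κ r).succ) : Fin (K + 1) × Fin (K + 1))) (fun _ => Equiv.refl S) y z
          + (1 - t) * prodKernel w M y z) (tensorFun (fun _ : Fin (K + 1) => ν)) (1 / 4) := by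
  classical
  set P := (fun y z : Fin (K + 1) → S => t * ptGraphSwap (fun _ : Fin (K + 1) => ν)
          (fun r : Fin m => (((0 : Fin (K + 1)), (κ r).succ) : Fin (K + 1) × Fin (K + 1))) (fun _ => Equiv.refl S) y z
          + (1 - t) * prodKernel w M y z) with hP
  have hq := homStar_lazy_tvDist_gt_quarter κ hm ht0 ht1 hK hν hν1 hM0 hidle hw0 hw00 hw1 hunif hmc u hu hn
  rw [← hP] at hq
  have hμ : ∀ (k : Fin (K + 1)) (x : S), 0 < (fun _ : Fin (K + 1) => ν) k x := fun _ x => hν x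
  have hrow := homStar_tensor_rowsum (K := K) (m := m) (w := w) (t := t) (M := M) hμ (fun _ => hν1) hw0 hw1 hM0 hidle
    (fun r : Fin m => (((0 : Fin (K + 1)), (κ r).succ) : Fin (K + 1) × Fin (K + 1))) (fun _ : Fin m => Equiv.refl S)
  have hDB := homStar_tensor_detailedBalance (K := K) (m := m) (w := w) (t := t) (M := M) hμ hM0 hidle
    (fun r : Fin m => (((0 : Fin (K + 1)), (κ r).succ) : Fin (K + 1) × Fin (K + 1))) (fun _ : Fin m => Equiv.refl S)
  have hMrs : ∀ k, IsRowStochastic (M k) := by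
    intro k
    refine Fin.cases ?_ (fun i => ?_) k
    · exact ⟨fun a b => by rw [hM0]; exact (hν b).le, fun a => by simp_rw [hM0]; exact hν1⟩
    · refine ⟨fun a b => by rw [hidle]; split_ifs <;> norm_num, fun a => ?_⟩
      simp_rw [hidle]; rw [Finset.sum_ite_eq' univ a]; simp
  have hPrs : IsRowStochastic P := by
    refine ⟨fun y z => ?_, fun y => hrow y⟩
    rw [hP]; simp only
    have h1 := (ptGraphSwap_isRowStochastic (e := fun r : Fin m => (((0 : Fin (K + 1)), (κ r).succ) : Fin (K + 1) × Fin (K + 1))) (φ := fun _ => Equiv.refl S) hμ).1 y z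
    have h2 := (prodKernel_isRowStochastic (P := M) (w := w) hw0 hw1 hMrs).1 y z
    exact add_nonneg (mul_nonneg ht0.le h1) (mul_nonneg (by linarith) h2)
  have hst : IsStationary (tensorFun (fun _ : Fin (K + 1) => ν)) P := hDB.isStationary hPrs.2
  by_contra h
  push Not at h
  obtain ⟨t₀, ht₀⟩ := hmix
  have hd := worstTvDist_le_of_mixingTime_le hPrs hst ht₀ h
  have hw' := tvDist_single_le_worstTvDist P (tensorFun (fun _ : Fin (K + 1) => ν)) n (fun _ : Fin (K + 1) => u)
  linarith

/-- **THE LAW-FREE `log K` FLOOR FOR CHAPTER U's HOMOGENEOUS SCHEME AT CONSTANT PERSISTENCE, as printed:** with `h = (1−t)w_0`, `q = t + h`, `t′ = t/q` and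
`n₀′ = (Kq²/(th) − 1)·log((K+t′)/max{260, 8√(2(K+1))})`, for every content law `ν > 0` with some `ν(u) ≤ ½` (given `¼`-closeness at some time):
**`t_mix(1/4) ≥ (n₀′ − 4)/(4q)`** — the unit `K(t+h)/(4th)` times `log K`. [ours] -/
theorem homStar_lazy_mixingTime_ge_lawFree (hm : 1 ≤ m) (ht0 : 0 < t) (ht1 : t < 1) (hK : 2 ≤ K) (hν : ∀ v, 0 < ν v) (hν1 : ∑ v, ν v = 1)
    (hM0 : ∀ u v, M 0 u v = ν v) (hidle : ∀ i : Fin K, ∀ u v, M i.succ u v = if v = u then 1 else 0)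
    (hw0 : ∀ k, 0 ≤ w k) (hw00 : 0 < w 0) (hw1 : ∑ k, w k = 1)
    (hunif : ∀ i : Fin K, (univ.filter fun r : Fin m => κ r = i).card = c) (hmc : m = c * K) (u : S) (hu : ν u ≤ 1 / 2)
    (hmix : ∃ t₀, worstTvDist (fun y z : Fin (K + 1) → S => t * ptGraphSwap (fun _ : Fin (K + 1) => ν)
          (fun r : Fin m => (((0 : Fin (K + 1)), (κ r).succ) : Fin (K + 1) × Fin (K + 1))) (fun _ => Equiv.refl S) y z
          + (1 - t) * prodKernel w M y z) (tensorFun (fun _ : Fin (K + 1) => ν)) t₀ ≤ 1 / 4) :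
    ((((K : ℝ) * (t + (1 - t) * w 0) ^ 2 / (t * ((1 - t) * w 0)) - 1)
        * Real.log (((K : ℝ) + t / (t + (1 - t) * w 0)) / max 260 (8 * Real.sqrt (2 * ((K : ℝ) + 1))))) - 4) / (4 * (t + (1 - t) * w 0))
      ≤ (mixingTime (fun y z : Fin (K + 1) → S => t * ptGraphSwap (fun _ : Fin (K + 1) => ν)
          (fun r : Fin m => (((0 : Fin (K + 1)), (κ r).succ) : Fin (K + 1) × Fin (K + 1))) (fun _ => Equiv.refl S) y z
          + (1 - t) * prodKernel w M y z) (tensorFun (fun _ : Fin (K + 1) => ν)) (1 / 4) : ℝ) := by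
  classical
  set q : ℝ := t + (1 - t) * w 0 with hqdef
  have hq0 : 0 < q := by rw [hqdef]; nlinarith
  set n₀ : ℝ := ((K : ℝ) * q ^ 2 / (t * ((1 - t) * w 0)) - 1) * Real.log (((K : ℝ) + t / q) / max 260 (8 * Real.sqrt (2 * ((K : ℝ) + 1)))) with hn₀def
  by_cases h4 : n₀ < 4
  · calc (n₀ - 4) / (4 * q) ≤ 0 := div_nonpos_of_nonpos_of_nonneg (by linarith) (by linarith)
      _ ≤ _ := Nat.cast_nonneg _
  push Not at h4
  -- the largest admissible `n`
  set n : ℕ := ⌊(n₀ - 4) / (4 * q)⌋₊ with hndef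
  have hnle : (n : ℝ) ≤ (n₀ - 4) / (4 * q) := Nat.floor_le (div_nonneg (by linarith) (by linarith))
  have hnlt : (n₀ - 4) / (4 * q) < n + 1 := Nat.lt_floor_add_one _
  have hn : 4 * q * n + 4 ≤ n₀ := by rw [le_div_iff₀ (by linarith)] at hnle; linarith
  have hlt := homStar_lazy_lt_mixingTime κ hm ht0 ht1 hK hν hν1 hM0 hidle hw0 hw00 hw1 hunif hmc u hu hmix hn
  have hcast : (n : ℝ) + 1 ≤ (mixingTime (fun y z : Fin (K + 1) → S => t * ptGraphSwap (fun _ : Fin (K + 1) => ν)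
          (fun r : Fin m => (((0 : Fin (K + 1)), (κ r).succ) : Fin (K + 1) × Fin (K + 1))) (fun _ => Equiv.refl S) y z
          + (1 - t) * prodKernel w M y z) (tensorFun (fun _ : Fin (K + 1) => ν)) (1 / 4) : ℝ) := by exact_mod_cast hlt
  linarith

end HomStarLazy

end Summit.Ventures.LatticeQCDFlow.Scaling

end
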